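import Literature.Probability.Percolation.HorizontalTransportLaw
import Literature.Probability.Percolation.TrackExchangeCleanAS
import Literature.Probability.LatticeModels.ProdBernoulliIndependence
import HarnessLib

/-!
# Transport of horizontal crossings through the regular block (GM14 Proposition 6.4) — III:
# the inequality on the strip

Grimmett–Manolescu, *Bond percolation on isoradial graphs* (PTRF 159 (2014) 273–327 =
arXiv:1204.0505), §6.2, Proposition 6.4 and its proof: with `E_N` "the event that there exists
an open path of `G` within `B(ρN, N)`, with endpoints `v_{x₀,0}` and `v_{x₁,0}` for some
`x₀ ∈ [-ρN, -(ρ-1)N]` and `x₁ ∈ [(ρ-1)N, ρN]`", "If `γ^{λN}` has maximal height not exceeding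
`λN`, then it contains a `γ^{λN}`-open horizontal crossing of `B((ρ-1)N, λN)` […] it suffices to
show the existence of `λ, N₀ ∈ ℕ` such that
`P(h(γ^{λN}) ≤ λN | ω^0) ≥ 1 - ρe^{-N}` for `N ≥ N₀`, `ω^0 ∈ E_N`" (6.14), concluded by
Lemma 6.7 (the growth process) applied to the dominated family of Lemma 6.6.

This file proves the resulting inequality between the canonical measures of the strip before
and after the `λN` blocks (`HData.weights 0` — GM14's `P_{α,β̃}` — and `HData.weights K`, which
agrees with `P_{α,β}` on the rows `0, …, λN - 1`):

* `HData.initEvent ρ N` = `E_N` (an open walk with the said endpoints, labels in `B(ρN, N)`,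
  primal), `HData.finalEvent ρ N` = an open walk with the same kind of endpoints and all heights
  in `[0, K]` (so a horizontal crossing of `B((ρ-1)N, K)`);
* **`HData.horizontal_transport_strip`**: for `0 < ε ≤ π/2` there are `λ, N₀ ≥ 1` such that for
  `ρ ≥ 1`, `N ≥ N₀`, valid data with `K = λN` and a wide enough strip,
  `(1 - ρe^{-N}) · P_{weights 0}(E_N) ≤ P_{weights K}(finalEvent)`.

Ingredients: the law `map_finalCfg`, the pathwise analysis (`heights_le_of_process_le`,
`procInv_traj`), the product bound `measure_forall_Yfin_le` feeding
`GrowthProcess.exists_measure_exists_lt_process_le` (Lemma 6.7), a measurable selection of the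
initial path (first candidate walk in an enumeration of `List SV`), and the a.s. cleanliness of
`P_{weights 0}`. The FKG step (6.12) bounding `P(E_N)` below by box crossings and the
identification with `P_{α,β}` on the box are not part of this file.

## References

* G. R. Grimmett, I. Manolescu, PTRF 159 (2014) 273–327, arXiv:1204.0505, §6.2, Proposition
  6.4, (6.10)–(6.14), Lemmas 6.6–6.7.
-/

noncomputable section

namespace Literature.Probability.Percolation

open LatticeModels StarTriangle Real MeasureTheory GrowthProcess

namespace TrackExchange

attribute [local instance] walkMeasurableSpace discreteMeasurableSpace_walk

/-! ### Generic measure-theoretic lemmas -/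

/-- **Averaging a lower section bound**: if every section of `G` above a point of `S` has
`ν`-measure at least `c`, then `c · μ S ≤ (μ ⊗ ν)((S × Y) ∩ G)`. [folklore] -/
theorem mul_le_prod_inter {X Y : Type*} [MeasurableSpace X] [MeasurableSpace Y] (μ : Measure X) (ν : Measure Y)
    [SFinite ν] {S : Set X} (hS : MeasurableSet S) {G : Set (X × Y)} (hG : MeasurableSet G) {c : ENNReal}
    (hc : ∀ x ∈ S, c ≤ ν (Prod.mk x ⁻¹' G)) : c * μ S ≤ (μ.prod ν) ((S ×ˢ Set.univ) ∩ G) := by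
  rw [Measure.prod_apply ((hS.prod MeasurableSet.univ).inter hG)]
  have hsec : ∀ x, S.indicator (fun _ => c) x ≤ ν (Prod.mk x ⁻¹' ((S ×ˢ Set.univ) ∩ G)) := by
    intro x
    by_cases hx : x ∈ S
    · rw [Set.indicator_of_mem hx]
      refine (hc x hx).trans (measure_mono fun y hy => ?_)
      exact ⟨⟨hx, Set.mem_univ _⟩, hy⟩
    · rw [Set.indicator_of_notMem hx]; exact bot_le
  calc c * μ S = ∫⁻ x, S.indicator (fun _ => c) x ∂μ := by rw [lintegral_indicator hS, setLIntegral_const]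
    _ ≤ ∫⁻ x, ν (Prod.mk x ⁻¹' ((S ×ˢ Set.univ) ∩ G)) ∂μ := lintegral_mono hsec

/-- A Boolean-valued map is measurable as soon as the preimage of `true` is. [folklore] -/
theorem measurable_bool_of_preimage {X : Type*} [MeasurableSpace X] {f : X → Bool}
    (h : MeasurableSet {x | f x = true}) : Measurable f := by
  refine measurable_to_countable' fun b => ?_
  cases b
  · have : f ⁻¹' {false} = {x | f x = true}ᶜ := by ext x; simp
    rw [this]; exact h.compl
  · exact h

/-- **The growth process is a measurable function of its indicator field.** [folklore] -/
theorem measurable_process {X : Type*} [MeasurableSpace X] {Yf : X → ℕ → ℤ → Bool}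
    (hY : ∀ k n, Measurable fun x => Yf x k n) (X₀ : ℤ → ℤ) :
    ∀ (k : ℕ) (n : ℤ), Measurable fun x => process (Yf x) X₀ k n
  | 0, n => by simp only [process_zero]; exact measurable_const
  | k + 1, n => by
    simp only [process_succ, GrowthProcess.step]
    have hg : Measurable fun t : (ℤ × ℤ) × (ℤ × Bool) => max (max t.1.1 t.1.2) (t.2.1 + (t.2.2).toNat) :=
      measurable_of_countable _
    exact hg.comp (((measurable_process hY X₀ k (n - 1)).prodMk (measurable_process hY X₀ k (n + 1))).prodMk
      ((measurable_process hY X₀ k n).prodMk (hY k n)))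

/-- The growth process depends only on the indicators at times `< k`. [folklore] -/
theorem process_congr {Y Y' : ℕ → ℤ → Bool} (X₀ : ℤ → ℤ) : ∀ k : ℕ, (∀ k' < k, Y k' = Y' k') →
    process Y X₀ k = process Y' X₀ k
  | 0, _ => rfl
  | k + 1, h => by
    rw [process_succ, process_succ, process_congr X₀ k fun k' hk' => h k' (by omega), h k (by omega)]

/-- The set of configurations in which a given walk is open is measurable. [folklore] -/
theorem measurableSet_setOf_isWalk : ∀ W : List SV, MeasurableSet {ω : Set (Sym2 SV) | IsWalk ω W}
  | [] => by simp
  | [_] => by simp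
  | a :: b :: l => by
    have h : {ω : Set (Sym2 SV) | IsWalk ω (a :: b :: l)} = {ω | s(a, b) ∈ ω} ∩ {ω | IsWalk ω (b :: l)} := by
      ext ω; simp [IsWalk]
    rw [h]
    exact (measurableSet_mem _).inter (measurableSet_setOf_isWalk (b :: l))

namespace HData

variable (H : HData)

/-! ### The events -/

/-- **A candidate initial path** for `E_N`: a walk from some `v_{x₀,0}`, `x₀ ∈ [-ρN, -(ρ-1)N]`,
to some `v_{x₁,0}`, `x₁ ∈ [(ρ-1)N, ρN]`, all of whose labels are primal and lie in the box
`B(ρN, N) = {|m| ≤ ρN, 0 ≤ y ≤ N}`. [cite: GrimmettManolescu2014Isoradial, §6.2] -/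
def Candidate (ρ N : ℕ) (W : List SV) : Prop :=
  (∃ x₀ : ℤ, W.head? = some (some (x₀, 0)) ∧ -((ρ * N : ℕ) : ℤ) ≤ x₀ ∧ x₀ ≤ -(((ρ - 1) * N : ℕ) : ℤ)) ∧
  (∃ x₁ : ℤ, W.getLast? = some (some (x₁, 0)) ∧ (((ρ - 1) * N : ℕ) : ℤ) ≤ x₁ ∧ x₁ ≤ ((ρ * N : ℕ) : ℤ)) ∧
  none ∉ W ∧ ∀ m y, some (m, y) ∈ W → |m| ≤ ((ρ * N : ℕ) : ℤ) ∧ 0 ≤ y ∧ y ≤ N ∧ Even (m + y)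

/-- **The event `E_N`**: some candidate path is open. [cite: GrimmettManolescu2014Isoradial, §6.2] -/
def initEvent (ρ N : ℕ) : Set (Set (Sym2 SV)) := {ω | ∃ W, Candidate ρ N W ∧ IsWalk ω W}

/-- **The target event**: an open walk from some `v_{x₀,0}`, `x₀ ∈ [-ρN, -(ρ-1)N]`, to some
`v_{x₁,0}`, `x₁ ∈ [(ρ-1)N, ρN]`, with all heights in `[0, K]` — it contains an open horizontal
crossing of `B((ρ-1)N, K)`. [cite: GrimmettManolescu2014Isoradial, §6.2 (6.14)] -/
def finalEvent (ρ N : ℕ) : Set (Set (Sym2 SV)) :=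
  {ω | ∃ W : List SV, IsWalk ω W ∧
    (∃ x₀ : ℤ, W.head? = some (some (x₀, 0)) ∧ -((ρ * N : ℕ) : ℤ) ≤ x₀ ∧ x₀ ≤ -(((ρ - 1) * N : ℕ) : ℤ)) ∧
    (∃ x₁ : ℤ, W.getLast? = some (some (x₁, 0)) ∧ (((ρ - 1) * N : ℕ) : ℤ) ≤ x₁ ∧ x₁ ≤ ((ρ * N : ℕ) : ℤ)) ∧
    none ∉ W ∧ ∀ m y, some (m, y) ∈ W → 0 ≤ y ∧ y ≤ H.K}

/-- `E_N` is measurable. [folklore] -/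
theorem measurableSet_initEvent (ρ N : ℕ) : MeasurableSet (initEvent ρ N) := by
  have h : initEvent ρ N = ⋃ W : List SV, {ω | Candidate ρ N W ∧ IsWalk ω W} := by
    ext ω; simp [initEvent]
  rw [h]
  refine MeasurableSet.iUnion fun W => ?_
  by_cases hW : Candidate ρ N W
  · have : {ω : Set (Sym2 SV) | Candidate ρ N W ∧ IsWalk ω W} = {ω | IsWalk ω W} := by ext ω; simp [hW]
    rw [this]; exact measurableSet_setOf_isWalk W
  · have : {ω : Set (Sym2 SV) | Candidate ρ N W ∧ IsWalk ω W} = ∅ := by ext ω; simp [hW]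
    rw [this]; exact MeasurableSet.empty

/-- The target event is measurable. [folklore] -/
theorem measurableSet_finalEvent (ρ N : ℕ) : MeasurableSet (H.finalEvent ρ N) := by
  set P : List SV → Prop := fun W =>
    (∃ x₀ : ℤ, W.head? = some (some (x₀, 0)) ∧ -((ρ * N : ℕ) : ℤ) ≤ x₀ ∧ x₀ ≤ -(((ρ - 1) * N : ℕ) : ℤ)) ∧
    (∃ x₁ : ℤ, W.getLast? = some (some (x₁, 0)) ∧ (((ρ - 1) * N : ℕ) : ℤ) ≤ x₁ ∧ x₁ ≤ ((ρ * N : ℕ) : ℤ)) ∧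
    none ∉ W ∧ ∀ m y, some (m, y) ∈ W → 0 ≤ y ∧ y ≤ H.K with hP
  have h : H.finalEvent ρ N = ⋃ W : List SV, {ω | IsWalk ω W ∧ P W} := by
    ext ω; simp only [finalEvent, hP, Set.mem_setOf_eq, Set.mem_iUnion]
  rw [h]
  refine MeasurableSet.iUnion fun W => ?_
  by_cases hW : P W
  · have : {ω : Set (Sym2 SV) | IsWalk ω W ∧ P W} = {ω | IsWalk ω W} := by ext ω; simp [hW]
    rw [this]; exact measurableSet_setOf_isWalk W
  · have : {ω : Set (Sym2 SV) | IsWalk ω W ∧ P W} = ∅ := by ext ω; simp [hW]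
    rw [this]; exact MeasurableSet.empty

/-! ### Measurability of the process in (initial configuration, noise) -/

/-- The trajectory is jointly measurable in the initial configuration and the noise, for a fixed
initial walk. [folklore] -/
theorem measurable_traj₂ (W : List SV) : ∀ (k : ℕ),
    Measurable fun p : Set (Sym2 SV) × (Fin H.K → H.BNoise) => H.traj (p.1, W) (H.extK p.2) k
  | 0 => by
    simp only [traj_zero]
    exact measurable_fst.prodMk measurable_const
  | k + 1 => by
    simp only [traj_succ]
    exact measurable_uncurry_comp (H.measurable_blockStep k) (measurable_traj₂ W k) ((H.measurable_extK k).comp measurable_snd)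

/-- The indicators `Y^k_n` are jointly measurable in the initial configuration and the noise.
[folklore] -/
theorem measurable_Yfin (W : List SV) (k : ℕ) (n : ℤ) :
    Measurable fun p : Set (Sym2 SV) × (Fin H.K → H.BNoise) => H.Yfin (p.1, W) p.2 k n := by
  unfold Yfin
  split_ifs with hk
  · refine measurable_bool_of_preimage ?_
    have h : {p : Set (Sym2 SV) × (Fin H.K → H.BNoise) | H.Yb (p.1, W) (H.extK p.2) k n = true} =
        (fun p => (H.traj (p.1, W) (H.extK p.2) k, p.2 ⟨k, hk⟩)) ⁻¹' {q | H.Ycond k q.1 q.2 n} := by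
      ext p
      simp only [Set.mem_setOf_eq, Set.mem_preimage]
      exact H.Yb_extK_eq_true_iff (p.1, W) p.2 ⟨k, hk⟩ n
    rw [h]
    exact ((H.measurable_traj₂ W k).prodMk ((measurable_pi_apply _).comp measurable_snd)) (H.measurableSet_Ycond k n)
  · exact measurable_const

/-- The event "the growth process stays below `K`" is measurable. [folklore] -/
theorem measurableSet_process_le (W : List SV) (X₀ : ℤ → ℤ) :
    MeasurableSet {p : Set (Sym2 SV) × (Fin H.K → H.BNoise) | ∀ n, process (H.Yfin (p.1, W) p.2) X₀ H.K n ≤ H.K} := by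
  have h : {p : Set (Sym2 SV) × (Fin H.K → H.BNoise) | ∀ n, process (H.Yfin (p.1, W) p.2) X₀ H.K n ≤ H.K} =
      ⋂ n : ℤ, (fun p => process (H.Yfin (p.1, W) p.2) X₀ H.K n) ⁻¹' {z | z ≤ H.K} := by
    ext p; simp
  rw [h]
  exact MeasurableSet.iInter fun n =>
    measurable_process (fun k n => H.measurable_Yfin W k n) X₀ H.K n (MeasurableSet.of_discrete)

/-! ### The pathwise conclusion -/

variable {H}

/-- **If the growth process stays below `K`, the configuration after `K` blocks lies in the
target event** (GM14: "If `γ^{λN}` has maximal height not exceeding `λN`, then it contains a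
`γ^{λN}`-open horizontal crossing"). [cite: GrimmettManolescu2014Isoradial, §6.2 (6.14)] -/
theorem finalCfg_mem_finalEvent {ε : ℝ} (hH : H.Valid ε) {ρ N : ℕ} {W : List SV}
    (hW : Candidate ρ N W) {ω : Set (Sym2 SV)} (hclean : Clean (H.weights 0) ω) (hwalk : IsWalk ω W)
    (hM : ((ρ + 1) * N : ℕ) + 2 * (H.K : ℤ) + 3 ≤ H.M) (V : Fin H.K → H.BNoise)
    (hX : ∀ n, process (H.Yfin (ω, W) V) (initialRange ρ N) H.K n ≤ H.K) :
    H.finalCfg ω V ∈ H.finalEvent ρ N := by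
  obtain ⟨⟨x₀, hh, hx₀, hx₀'⟩, ⟨x₁, hl, hx₁, hx₁'⟩, hnone, hlab⟩ := hW
  have hP₀ : ∃ a : ℤ, (some (x₀, (0 : ℤ)) : SV) = some (a, 0) := ⟨x₀, rfl⟩
  have hP₁ : ∃ a : ℤ, (some (x₁, (0 : ℤ)) : SV) = some (a, 0) := ⟨x₁, rfl⟩
  have h0 : H.ProcInv (some (x₀, 0)) (some (x₁, 0)) (((ρ + 1) * N : ℕ) : ℤ) 0 (ω, W) := by
    refine ⟨hclean, hwalk, hh, hl, hnone, fun m y hm => (hlab m y hm).2.2.2, fun m y hm => (hlab m y hm).2.1,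
      fun m y hm => ?_⟩
    have h1 := (hlab m y hm).1
    have h2 := (hlab m y hm).2.2.1
    push_cast at h1 h2 ⊢
    nlinarith [h1, h2]
  have hM' : (((ρ + 1) * N : ℕ) : ℤ) + 2 * H.K + 3 ≤ H.M := by exact_mod_cast hM
  have hinit : ∀ n, H.hgt (ω, W) (H.extK V) 0 n ≤ (initialRange ρ N n : WithBot ℤ) := by
    intro n
    unfold hgt
    simp only [traj_zero, shift, add_zero]
    refine colmax_le fun y hy => ?_
    have h1 := hlab n y hy
    rw [initialRange_of_abs_le (by exact_mod_cast h1.1)]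
    exact_mod_cast h1.2.2.1
  -- the process fed with `Yfin` is the process fed with `Yb` up to time `K`
  have hYeq : ∀ k < H.K, H.Yfin (ω, W) V k = H.Yb (ω, W) (H.extK V) k := by
    intro k hk; funext n; simp [Yfin, hk]
  have hX' : ∀ n, process (H.Yb (ω, W) (H.extK V)) (initialRange ρ N) H.K n ≤ H.K := by
    intro n; rw [← process_congr (initialRange ρ N) H.K hYeq]; exact hX n
  have hhts := heights_le_of_process_le hH hP₀ hP₁ hM' h0 (H.extK V) ρ N hinit hX'
  have hinv := procInv_traj hH hP₀ hP₁ hM' h0 (H.extK V) H.K le_rfl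
  refine ⟨(H.traj (ω, W) (H.extK V) H.K).2, ?_, ⟨x₀, hinv.head, hx₀, hx₀'⟩, ⟨x₁, hinv.last, hx₁, hx₁'⟩,
    hinv.none_not_mem, fun m y hm => ?_⟩
  · have h1 : H.finalCfg ω V = (H.traj (ω, W) (H.extK V) H.K).1 := (H.traj_fst (ω, W) V).symm
    rw [h1]; exact hinv.walk
  · have := hhts m y hm; exact ⟨this.1, this.2⟩

/-! ### The inequality -/

/-- **Transport of horizontal crossings through the regular block, on the strip** (GM14
Proposition 6.4 with `E_N` in place of its FKG lower bound (6.12)): for `0 < ε ≤ π/2` there are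
`λ, N₀ ≥ 1` (depending on `ε` only) such that for all `ρ ≥ 1`, `N ≥ N₀` and all valid data with
`K = λN` blocks and half-width `M ≥ (ρ+1)N + 2λN + 3` (any block height `H.N ≥ 1`; in GM14 it
is `N`),
`(1 - ρe^{-N}) · P_{weights 0}(E_N) ≤ P_{weights K}(finalEvent)`.
[cite: GrimmettManolescu2014Isoradial, §6.2 Proposition 6.4] -/
theorem horizontal_transport_strip {ε : ℝ} (hε : 0 < ε) (hε' : ε ≤ π / 2) :
    ∃ lam N₀ : ℕ, 1 ≤ lam ∧ ∀ (ρ N : ℕ), 1 ≤ ρ → N₀ ≤ N → ∀ (H : HData), H.Valid ε → H.K = lam * N →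
      (((ρ + 1) * N : ℕ) : ℤ) + 2 * (lam * N : ℕ) + 3 ≤ H.M →
      ENNReal.ofReal (1 - ρ * Real.exp (-N)) * prodBernoulli (H.weights 0) (initEvent ρ N) ≤
        prodBernoulli (H.weights H.K) (H.finalEvent ρ N) := by
  classical
  set η := rateBound ε with hη
  have hη0 : 0 ≤ η := (rateBound_pos hε.le hε').le
  have hη1 : η < 1 := rateBound_lt_one hε hε'
  obtain ⟨lam, N₀, hlam, hgrow⟩ := exists_measure_exists_lt_process_le hη0 hη1
  refine ⟨lam, N₀, hlam, fun ρ N hρ hN H hH hK hM => ?_⟩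
  set P₀ := prodBernoulli (H.weights 0) with hP₀
  set Q : Measure (Fin H.K → H.BNoise) := Measure.pi fun _ : Fin H.K => H.piNoise with hQ
  set δ : ENNReal := ENNReal.ofReal (1 - ρ * Real.exp (-N)) with hδ
  set X₀ := initialRange ρ N with hX₀
  -- Step 1: the right-hand side as a probability of the joint process
  rw [← H.map_finalCfg hH, Measure.map_apply H.measurable_finalCfg (H.measurableSet_finalEvent ρ N)]
  -- Step 2: the disjoint pieces
  set E : List SV → Set (Set (Sym2 SV)) := fun W =>
    {ω | Candidate ρ N W ∧ IsWalk ω W ∧ Clean (H.weights 0) ω ∧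
      ∀ W' : List SV, Encodable.encode W' < Encodable.encode W → ¬ (Candidate ρ N W' ∧ IsWalk ω W')} with hE
  set G : List SV → Set (Set (Sym2 SV) × (Fin H.K → H.BNoise)) := fun W =>
    {p | ∀ n, process (H.Yfin (p.1, W) p.2) X₀ H.K n ≤ H.K} with hG
  have hEm : ∀ W, MeasurableSet (E W) := by
    intro W
    have h : E W = {ω | Candidate ρ N W} ∩ {ω | IsWalk ω W} ∩ {ω | Clean (H.weights 0) ω} ∩
        ⋂ W' : List SV, {ω | Encodable.encode W' < Encodable.encode W → ¬ (Candidate ρ N W' ∧ IsWalk ω W')} := by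
      ext ω; simp [hE, and_assoc]
    rw [h]
    refine (((MeasurableSet.const _).inter (measurableSet_setOf_isWalk W)).inter (measurableSet_setOf_clean _)).inter
      (MeasurableSet.iInter fun W' => ?_)
    by_cases h1 : Encodable.encode W' < Encodable.encode W ∧ Candidate ρ N W'
    · have : {ω : Set (Sym2 SV) | Encodable.encode W' < Encodable.encode W → ¬ (Candidate ρ N W' ∧ IsWalk ω W')} =
          {ω | IsWalk ω W'}ᶜ := by ext ω; simp [h1.1, h1.2]
      rw [this]; exact (measurableSet_setOf_isWalk W').compl
    · have : {ω : Set (Sym2 SV) | Encodable.encode W' < Encodable.encode W → ¬ (Candidate ρ N W' ∧ IsWalk ω W')} =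
          Set.univ := by
        ext ω; simp only [Set.mem_setOf_eq, Set.mem_univ, iff_true]
        intro hlt ⟨hc, _⟩; exact h1 ⟨hlt, hc⟩
      rw [this]; exact MeasurableSet.univ
  have hGm : ∀ W, MeasurableSet (G W) := fun W => H.measurableSet_process_le W X₀
  have hEdisj : Pairwise (Function.onFun Disjoint E) := by
    intro W W' hne
    rw [Function.onFun, Set.disjoint_left]
    intro ω h h'
    rcases lt_trichotomy (Encodable.encode W) (Encodable.encode W') with hlt | heq | hgt
    · exact h'.2.2.2 W hlt ⟨h.1, h.2.1⟩
    · exact hne (Encodable.encode_injective heq)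
    · exact h.2.2.2 W' hgt ⟨h'.1, h'.2.1⟩
  -- Step 3: the pieces lie in the preimage of the target event
  have hsub : (⋃ W, (E W ×ˢ Set.univ) ∩ G W) ⊆ Function.uncurry H.finalCfg ⁻¹' H.finalEvent ρ N := by
    intro p hp
    simp only [Set.mem_iUnion, Set.mem_inter_iff, Set.mem_prod, Set.mem_univ, and_true] at hp
    obtain ⟨W, hpE, hpG⟩ := hp
    have hM' : ((ρ + 1) * N : ℕ) + 2 * (H.K : ℤ) + 3 ≤ H.M := by rw [hK]; exact_mod_cast hM
    exact finalCfg_mem_finalEvent hH hpE.1 hpE.2.2.1 hpE.2.1 hM' p.2 hpG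
  -- Step 4: each piece has conditional probability at least `1 - ρe^{-N}`
  have hsec : ∀ W, ∀ ω ∈ E W, δ ≤ Q (Prod.mk ω ⁻¹' G W) := by
    intro W ω _
    have hbad := hgrow ρ N hρ hN Q (fun k n V => H.Yfin (ω, W) V k n) (fun T => measure_forall_Yfin_le hH (ω, W) T)
    have hset : Prod.mk ω ⁻¹' G W = {V | ∃ n, (lam * N : ℤ) < process (fun k l => H.Yfin (ω, W) V k l) X₀ (lam * N) n}ᶜ := by
      ext V
      simp only [hG, Set.mem_preimage, Set.mem_setOf_eq, Set.mem_compl_iff, not_exists, not_lt, hK]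
      push_cast
      rfl
    have hmeas : MeasurableSet {V | ∃ n, (lam * N : ℤ) < process (fun k l => H.Yfin (ω, W) V k l) X₀ (lam * N) n} := by
      have : {V : Fin H.K → H.BNoise | ∃ n, (lam * N : ℤ) < process (fun k l => H.Yfin (ω, W) V k l) X₀ (lam * N) n} =
          ⋃ n : ℤ, (fun V => process (fun k l => H.Yfin (ω, W) V k l) X₀ (lam * N) n) ⁻¹' {z | (lam * N : ℤ) < z} := by
        ext V; simp
      rw [this]
      refine MeasurableSet.iUnion fun n => measurable_process (fun k l => ?_) X₀ (lam * N) n MeasurableSet.of_discrete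
      exact (H.measurable_Yfin W k l).comp (measurable_const.prodMk measurable_id)
    rw [hset, measure_compl hmeas (measure_ne_top _ _), measure_univ, hδ]
    calc ENNReal.ofReal (1 - ρ * Real.exp (-N)) = ENNReal.ofReal 1 - ENNReal.ofReal (ρ * Real.exp (-N)) :=
          ENNReal.ofReal_sub 1 (by positivity)
      _ = 1 - ENNReal.ofReal (ρ * Real.exp (-N)) := by rw [ENNReal.ofReal_one]
      _ ≤ 1 - Q {V | ∃ n, (lam * N : ℤ) < process (fun k l => H.Yfin (ω, W) V k l) X₀ (lam * N) n} :=
          tsub_le_tsub_left hbad 1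
  -- Step 5: assemble
  have hcover : initEvent ρ N ∩ {ω | Clean (H.weights 0) ω} ⊆ ⋃ W, E W := by
    rintro ω ⟨⟨W, hW, hw⟩, hc⟩
    have hex : ∃ m, ∃ W' : List SV, Encodable.encode W' = m ∧ Candidate ρ N W' ∧ IsWalk ω W' := ⟨_, W, rfl, hW, hw⟩
    obtain ⟨W₁, hW₁, hc₁, hw₁⟩ := Nat.find_spec hex
    refine Set.mem_iUnion.2 ⟨W₁, hc₁, hw₁, hc, fun W' hlt h' => ?_⟩
    have := Nat.find_min hex (hW₁ ▸ hlt)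
    exact this ⟨W', rfl, h'.1, h'.2⟩
  have hP₀E : P₀ (initEvent ρ N) ≤ P₀ (⋃ W, E W) := by
    calc P₀ (initEvent ρ N) ≤ P₀ (initEvent ρ N ∩ {ω | Clean (H.weights 0) ω}) + P₀ {ω | ¬ Clean (H.weights 0) ω} := by
          refine (measure_mono fun ω hω => ?_).trans (measure_union_le _ _)
          by_cases hc : Clean (H.weights 0) ω
          · exact Or.inl ⟨hω, hc⟩
          · exact Or.inr hc
      _ = P₀ (initEvent ρ N ∩ {ω | Clean (H.weights 0) ω}) := by
          rw [hP₀, prodBernoulli_setOf_not_clean, add_zero]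
      _ ≤ P₀ (⋃ W, E W) := measure_mono hcover
  calc δ * P₀ (initEvent ρ N) ≤ δ * P₀ (⋃ W, E W) := mul_le_mul' le_rfl hP₀E
    _ = ∑' W, δ * P₀ (E W) := by rw [measure_iUnion hEdisj hEm, ENNReal.tsum_mul_left]
    _ ≤ ∑' W, (P₀.prod Q) ((E W ×ˢ Set.univ) ∩ G W) :=
        ENNReal.tsum_le_tsum fun W => mul_le_prod_inter P₀ Q (hEm W) (hGm W) (hsec W)
    _ = (P₀.prod Q) (⋃ W, (E W ×ˢ Set.univ) ∩ G W) := by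
        rw [measure_iUnion ?_ fun W => ((hEm W).prod MeasurableSet.univ).inter (hGm W)]
        intro W W' hne
        rw [Function.onFun, Set.disjoint_left]
        rintro ⟨ω, V⟩ ⟨⟨h1, -⟩, -⟩ ⟨⟨h2, -⟩, -⟩
        exact Set.disjoint_left.1 (hEdisj hne) h1 h2
    _ ≤ (P₀.prod Q) (Function.uncurry H.finalCfg ⁻¹' H.finalEvent ρ N) := measure_mono hsub

end HData

end TrackExchange

end Literature.Probability.Percolation
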